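import Summits.FinalStateConjecture.FinalStateConjecture.Theses.PhotonSphereChannels
import Literature.Geometry.Lorentzian.CausalityClosedProofs

/-!
# The faithful future domain of dependence: sanity lemmas, and the one-line core of the vendored endpoint junk
(negative-side support for crux `TameCensorship`, `stmt-FinalStateConjecture-10047`, cdisprove seat, cycle 3)

Context. The drefuter of line `crush-the-swallowed-interior` showed (2026-08-16) that the vendored
`LorentzianMetric.futureCauchyDevelopment` of a CLOSED set is the set itself, because the vendored
`IsPastInextendible γ s := s.Nonempty ∧ (¬ BddBelow s ∨ …)` makes every curve on a parameter set unbounded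
below "past-inextendible"; the lead repaired `IsCrushable` / `NullTerminality` with the FAITHFUL domain of
dependence built on `IsPastEndless`. This file records

* `isPastInextendible_Iic`, `isFutureInextendible_Ici`: the one-line core of the defect — EVERY curve on a
  half-line is vendored-inextendible — against `hasPastEndpoint_const` / `not_isPastEndless_const` (the
  faithful notion rejects a constant curve). The crux `TameCensorship` itself uses none of the vendored
  endpoint notions (its `CauchyDevelopment` is over the faithful `IsCauchyHypersurface`, its rays are maximal
  affinely parametrised geodesics, its chart clauses are `ℝ≥0∞` suprema): it is immune.
* the faithful `D⁺` — verbatim the lead's `futureDomainOfDependence`, written out as the set-builder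
  inlined in the registered stubs C, N, R (no new definition) — with `subset_fdod`, `fdod_mono`, `fdod_subset_causalFuture` (`D⁺(S) ⊆ J⁺(S)`,
  by the tree's `exists_isEndlessTimelikeCurve_through`) and `fdod_empty` (`D⁺(∅) = ∅`): the REPAIRED
  null terminality has an unsatisfiable hypothesis at the empty hypersurface and only there, and the repaired
  crushability keeps the empty witness exactly when `J⁺(ιK)` is relatively compact — the degenerate-instance
  attack that voided the vendored objects fails honestly on the repaired ones.
* `causalFuture_empty'`, `chronologicalFuture_empty'`: `J⁺(∅) = I⁺(∅) = ∅` (with `K = ∅` the swallowed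
  region is empty and (C1), (C2), R1a, R1b say nothing).
-/

noncomputable section

open Bundle TopologicalSpace Manifold Set
open scoped ContDiff Topology

namespace Summit.FinalStateConjecture.FinalStateConjecture.Theorems.TameCensorship.Negative

open Literature.Geometry.Lorentzian

universe u

section EndpointJunk

variable {M' : Type*} [TopologicalSpace M']

/-- **The vendored inextendibility is decided by the parameter set alone**: EVERY curve on a left
half-line `(-∞, t₀]` is `IsPastInextendible` (first disjunct), whatever its behaviour. -/
theorem isPastInextendible_Iic (γ : ℝ → M') (t₀ : ℝ) : IsPastInextendible γ (Iic t₀) :=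
  ⟨nonempty_Iic, Or.inl (not_bddBelow_Iic t₀)⟩

/-- Time dual: every curve on `[t₀, ∞)` is vendored-future-inextendible. -/
theorem isFutureInextendible_Ici (γ : ℝ → M') (t₀ : ℝ) : IsFutureInextendible γ (Ici t₀) :=
  ⟨nonempty_Ici, Or.inl (not_bddAbove_Ici t₀)⟩

/-- The faithful notion sees endpoints: a constant curve has its value as past endpoint on every
parameter set … -/
theorem hasPastEndpoint_const (p : M') (s : Set ℝ) : HasPastEndpoint (fun _ : ℝ ↦ p) s p :=
  tendsto_const_nhds

/-- … hence is never past-ENDLESS. -/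
theorem not_isPastEndless_const (p : M') (s : Set ℝ) : ¬ IsPastEndless (fun _ : ℝ ↦ p) s :=
  fun h ↦ h.2 p (hasPastEndpoint_const p s)

end EndpointJunk

section Faithful

/-! The FAITHFUL future domain of dependence of `S` in the spacetime `𝓢` — verbatim the lead's
`futureDomainOfDependence 𝓢 S` (`Cruxes/TameCensorship/Lines/crush-the-swallowed-interior.lean`, repair of
2026-08-16), written out as the set-builder that is inlined in the registered stubs C, N, R (no definition is
introduced here, so the lemmas apply to the stubs' texts by `exact`):
`{p | ∀ β s, s.OrdConnected → IsFutureCausalCurveOn β s → IsPastEndless β s → ∀ t₀ ∈ s, β t₀ = p →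
∃ t ∈ s, t ≤ t₀ ∧ β t ∈ S}`. -/

variable (𝓢 : Spacetime.{u} 4)

/-- `S ⊆ D⁺(S)` (faithful `D⁺`). -/
theorem subset_fdod (S : Set 𝓢.carrier) :
    S ⊆ {p : 𝓢.carrier | ∀ (β : ℝ → 𝓢.carrier) (s : Set ℝ), s.OrdConnected →
        𝓢.metric.IsFutureCausalCurveOn 𝓢.timeOrientation β s → IsPastEndless β s →
        ∀ t₀ ∈ s, β t₀ = p → ∃ t ∈ s, t ≤ t₀ ∧ β t ∈ S} :=
  fun _ hp _ _ _ _ _ t₀ ht₀ hγp ↦ ⟨t₀, ht₀, le_rfl, hγp ▸ hp⟩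

/-- The faithful `D⁺` is monotone in `S`. -/
theorem fdod_mono {S S' : Set 𝓢.carrier} (h : S ⊆ S') :
    {p : 𝓢.carrier | ∀ (β : ℝ → 𝓢.carrier) (s : Set ℝ), s.OrdConnected →
        𝓢.metric.IsFutureCausalCurveOn 𝓢.timeOrientation β s → IsPastEndless β s →
        ∀ t₀ ∈ s, β t₀ = p → ∃ t ∈ s, t ≤ t₀ ∧ β t ∈ S} ⊆
    {p : 𝓢.carrier | ∀ (β : ℝ → 𝓢.carrier) (s : Set ℝ), s.OrdConnected →
        𝓢.metric.IsFutureCausalCurveOn 𝓢.timeOrientation β s → IsPastEndless β s →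
        ∀ t₀ ∈ s, β t₀ = p → ∃ t ∈ s, t ≤ t₀ ∧ β t ∈ S'} :=
  fun _ hp β s hs hβ he t₀ ht₀ hβp ↦
    let ⟨t, ht, htle, htS⟩ := hp β s hs hβ he t₀ ht₀ hβp
    ⟨t, ht, htle, h htS⟩

/-- **`D⁺(S) ⊆ J⁺(S)`** for the faithful `D⁺`: the endless timelike curve through `p`
(`exists_isEndlessTimelikeCurve_through`) meets `S` at or before `p`. -/
theorem fdod_subset_causalFuture (S : Set 𝓢.carrier) :
    {p : 𝓢.carrier | ∀ (β : ℝ → 𝓢.carrier) (s : Set ℝ), s.OrdConnected →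
        𝓢.metric.IsFutureCausalCurveOn 𝓢.timeOrientation β s → IsPastEndless β s →
        ∀ t₀ ∈ s, β t₀ = p → ∃ t ∈ s, t ≤ t₀ ∧ β t ∈ S} ⊆
      𝓢.metric.causalFuture 𝓢.timeOrientation S := by
  intro p hp
  obtain ⟨Δ, D, hΔ, h0D, hΔ0⟩ :=
    LorentzianMetric.exists_isEndlessTimelikeCurve_through (g := 𝓢.metric) (τ := 𝓢.timeOrientation)
      (WithTop.coe_le_coe.mpr le_top : (2 : ℕ∞ω) ≤ ∞) p
  obtain ⟨t, htD, ht0, htS⟩ := hp Δ D hΔ.1 hΔ.2.1.isFutureCausalCurveOn hΔ.2.2.2 0 h0D hΔ0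
  rcases ht0.eq_or_lt with rfl | hlt
  · exact LorentzianMetric.subset_causalFuture (g := 𝓢.metric) (τ := 𝓢.timeOrientation) S (hΔ0 ▸ htS)
  · refine Or.inr ⟨Δ t, htS, Δ, t, 0, hlt, ?_, rfl, hΔ0⟩
    exact (hΔ.2.1.mono (hΔ.1.out htD h0D)).isFutureCausalCurveOn

/-- **`D⁺(∅) = ∅` for the faithful `D⁺`** (contrast: vendored `D⁺(S) = S` for every closed `S`,
`futureCauchyDevelopment_eq_self_of_isClosed`). So the REPAIRED null terminality has an unsatisfiable
hypothesis ("eventually in `D⁺(∅)`") at the empty hypersurface and only there, and the repaired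
crushability keeps the empty witness exactly when `J⁺(ιK)` is relatively compact. -/
theorem fdod_empty :
    {p : 𝓢.carrier | ∀ (β : ℝ → 𝓢.carrier) (s : Set ℝ), s.OrdConnected →
        𝓢.metric.IsFutureCausalCurveOn 𝓢.timeOrientation β s → IsPastEndless β s →
        ∀ t₀ ∈ s, β t₀ = p → ∃ t ∈ s, t ≤ t₀ ∧ β t ∈ (∅ : Set 𝓢.carrier)} = ∅ :=
  Set.eq_empty_of_subset_empty <| (fdod_subset_causalFuture 𝓢 ∅).trans <| by
    rintro q (hq | ⟨p, hp, -⟩)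
    · exact hq
    · exact hp.elim

variable {E : Type*} [NormedAddCommGroup E] [NormedSpace ℝ E] {H : Type*} [TopologicalSpace H]
  {I : ModelWithCorners ℝ E H} {n : ℕ∞ω} {M' : Type*} [TopologicalSpace M'] [ChartedSpace H M']
  [IsManifold I ∞ M']

/-- `J⁺(∅) = ∅`. -/
theorem causalFuture_empty' (g : LorentzianMetric I n M') (τ : TimeOrientation g) :
    g.causalFuture τ ∅ = ∅ := by
  ext q; simp [LorentzianMetric.mem_causalFuture_iff]

/-- `I⁺(∅) = ∅`. -/
theorem chronologicalFuture_empty' (g : LorentzianMetric I n M') (τ : TimeOrientation g) :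
    g.chronologicalFuture τ ∅ = ∅ := by
  ext q; simp [LorentzianMetric.mem_chronologicalFuture_iff]

end Faithful

end Summit.FinalStateConjecture.FinalStateConjecture.Theorems.TameCensorship.Negative

end
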